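import Literature.Probability.Percolation.ArmSeparationExtSlotArith
import HarnessLib

/-!
# The transfer tube of an exit leaving the common staircase ring system

Topic: Probability / Percolation; family `crit-perc`. A brick of the GENERIC landing layer of
Nolin's arm-separation theorem (Nolin 2008, Thm. 11, §4.3 Prop. 12 and §4.4 [arXiv 0711.4948:
Prop. 11, Thm. 10, p. 12, Fig. 6: "RSW in corridors"]), towards
`Literature.Probability.Percolation.Nolin2008_prop17_quasiMult` (`FiveArmExponentFacts.lean`).

All exits climb the SAME frame-`0` system of thin rings and level connectors (so that their
cells agree); at the top ring (radius `r`) the exit bound for the landing side `i` leaves it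
through a TRANSFER TUBE of its own frame `i`: the horizontal tube
`transferTube r r' e s ι h = [r - 2e, r' + e] × [-r + ι s, -r + ι s + h]`, read through `ρ^i`,
from inside the band of the top ring at its cell `ι` of the side `i` out to the ring of radius
`r'` of the frame `i`, where the standard side-`0` landing (`out_landing_glue`) takes over. Its
bottom junction with the frame-`0` ring piece at that cell is in the position
`SpokeMeetsRot i (transferTube …) (ringTube r e s (extPos n i ι))` (`spokeMeetsRot_transfer`;
thin: `h ≤ e`), so `rotTube_meets_crossing` (`RotTubeMeets.lean`) joins the crossings; its top
junction is the plus `Crosses (transferTube …) (vPiece r' (-r') e s (ι + q))` of its own frame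
(`crosses_transfer_vPiece`, `r' = r + q s`).

## Main results

* `transferTube`, `spokeMeetsRot_transfer`, `crosses_transfer_vPiece`, `transferTube_box`.

## References

* P. Nolin, *Near-critical percolation in two dimensions*, Electron. J. Probab. 13 (2008), §4.3
  Prop. 12 (proof), §4.4 (arXiv 0711.4948: Prop. 11; proof of Thm. 10, p. 12, Fig. 6). [Nolin2008]
-/

noncomputable section

namespace Literature.Probability.Percolation

open LatticeModels Tube

/-- **The transfer tube** of the cell `ι` of the top ring of radius `r`, out to the radius `r'`
of its landing frame: `[r - 2e, r' + e] × [-r + ι s, -r + ι s + h]`, crossed horizontally. [cite: Nolin2008, §4.4 (arXiv 0711.4948: proof of Thm. 10, p. 12, Fig. 6)] -/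
def transferTube (r r' e s ι h : ℕ) : Tube := ⟨(r : ℤ) - 2 * e, -(r : ℤ) + ι * s, r' - r + 3 * e, h, true⟩

section Junction

variable {r r' e s ι h : ℕ}

/-- Frame `0`: the transfer tube meets `V_ι`. [folklore] -/
theorem transferMeets_zero (hrr' : r ≤ r') (hh : h ≤ e) :
    SpokeMeetsRot 0 (transferTube r r' e s ι h) (vPiece r (-(r : ℤ)) e s ι) := by
  refine ⟨rfl, ?_, ?_, ?_, ?_⟩ <;>
    simp only [transferTube, vPiece, Nat.cast_add, Nat.cast_mul, Nat.cast_ofNat, Nat.cast_sub hrr'] <;> nlinarith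

/-- Frame `1`: the transfer tube meets `H_ι`. [folklore] -/
theorem transferMeets_one (hrr' : r ≤ r') (hh : h ≤ e) :
    SpokeMeetsRot 1 (transferTube r r' e s ι h) (stairH r e s ι) := by
  refine ⟨rfl, ?_, ?_, ?_, ?_⟩ <;>
    simp only [transferTube, stairH, Nat.cast_add, Nat.cast_mul, Nat.cast_ofNat, Nat.cast_sub hrr'] <;> nlinarith

/-- Frame `2`: the transfer tube meets the horizontal piece `H_ι` of the side `x₁ = r`. [folklore] -/
theorem transferMeets_two (hrr' : r ≤ r') (hh : h ≤ e) (hes : h + e ≤ s) :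
    SpokeMeetsRot 2 (transferTube r r' e s ι h) (hPiece 0 r e s ι) := by
  refine ⟨rfl, ?_, ?_, ?_, ?_⟩ <;>
    simp only [transferTube, hPiece, Nat.cast_add, Nat.cast_mul, Nat.cast_ofNat, Nat.cast_sub hrr'] <;> nlinarith

/-- Frame `3`: the transfer tube meets `-V_ι`. [folklore] -/
theorem transferMeets_three (hrr' : r ≤ r') (hh : h ≤ e) :
    SpokeMeetsRot 3 (transferTube r r' e s ι h) (vPiece r (-(r : ℤ)) e s ι).neg := by
  refine ⟨rfl, ?_, ?_, ?_, ?_⟩ <;>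
    simp only [transferTube, vPiece, Tube.neg, Nat.cast_add, Nat.cast_mul, Nat.cast_ofNat, Nat.cast_sub hrr'] <;>
    nlinarith

/-- Frame `4`: the transfer tube meets `-H_ι`. [folklore] -/
theorem transferMeets_four (hrr' : r ≤ r') (hh : h ≤ e) :
    SpokeMeetsRot 4 (transferTube r r' e s ι h) (stairH r e s ι).neg := by
  refine ⟨rfl, ?_, ?_, ?_, ?_⟩ <;>
    simp only [transferTube, stairH, Tube.neg, Nat.cast_add, Nat.cast_mul, Nat.cast_ofNat, Nat.cast_sub hrr'] <;>
    nlinarith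

/-- Frame `5`: the transfer tube meets `-H_ι` of the side `x₁ = -r`. [folklore] -/
theorem transferMeets_five (hrr' : r ≤ r') (hh : h ≤ e) (hes : h + e ≤ s) :
    SpokeMeetsRot 5 (transferTube r r' e s ι h) (hPiece 0 r e s ι).neg := by
  refine ⟨rfl, ?_, ?_, ?_, ?_⟩ <;>
    simp only [transferTube, hPiece, Tube.neg, Nat.cast_add, Nat.cast_mul, Nat.cast_ofNat, Nat.cast_sub hrr'] <;>
    nlinarith

/-- **The transfer tube of the frame `i` meets the top-ring piece of its cell**
`ringTube r e s (extPos n i ι)` (`n s = r ≤ r'`, `ι < n`, thin: `h ≤ e`, `h + e ≤ s`). [cite: Nolin2008, §4.3 Prop. 12 (proof) and §4.4 (arXiv 0711.4948: Prop. 11; Thm. 10, p. 12)] -/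
theorem spokeMeetsRot_transfer {i n : ℕ} (hi : i < 6) (hs : 1 ≤ s) (hns : n * s = r) (hn : 1 ≤ n) (hιn : ι < n)
    (hrr' : r ≤ r') (hh : h ≤ e) (hes : h + e ≤ s) :
    SpokeMeetsRot i (transferTube r r' e s ι h) (ringTube r e s (extPos n i ι)) := by
  have hn' : n = r / s := by rw [← hns, Nat.mul_div_cancel _ hs]
  subst hn'
  rw [ringTube_extPos hn hi hιn]
  unfold pieceTube extIdx
  interval_cases i
  · exact transferMeets_zero hrr' hh
  · exact transferMeets_one hrr' hh
  · simp only [show (2 : ℕ) % 3 = 2 from rfl, if_true]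
    rw [show r / s - 1 - (r / s - 1 - ι) = ι by omega]
    exact transferMeets_two hrr' hh hes
  · exact transferMeets_three hrr' hh
  · exact transferMeets_four hrr' hh
  · simp only [show (5 : ℕ) % 3 = 2 from rfl, if_true]
    rw [show r / s - 1 - (r / s - 1 - ι) = ι by omega]
    exact transferMeets_five hrr' hh hes

end Junction

/-- **The top junction**: in its own frame, the transfer tube crosses the vertical piece of the
ring of radius `r' = r + q s` at the rank `ι + q` like a plus (`h ≤ s`). [folklore] -/
theorem crosses_transfer_vPiece {r r' e s ι h q : ℕ} (hq : r' = r + q * s) (hhs : h ≤ s) :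
    Crosses (transferTube r r' e s ι h) (vPiece r' (-(r' : ℤ)) e s (ι + q)) := by
  have hrr' : r ≤ r' := by rw [hq]; exact Nat.le_add_right _ _
  have hqz : (r' : ℤ) = r + q * s := by rw [hq]; push_cast; ring
  refine Or.inl ⟨rfl, rfl, ?_, ?_, ?_, ?_⟩ <;>
    simp only [transferTube, vPiece, Nat.cast_add, Nat.cast_mul, Nat.cast_ofNat, Nat.cast_sub hrr'] <;> nlinarith

/-- **Where the transfer tube is**: columns `[r - 2e, r' + e]`, rows `[-r + ι s, -r + ι s + h]`. [folklore] -/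
theorem transferTube_box {r r' e s ι h : ℕ} (hrr' : r ≤ r') {v : Site 2} (hv : v ∈ (transferTube r r' e s ι h).box) :
    (r : ℤ) - 2 * e ≤ v 0 ∧ v 0 ≤ r' + e ∧ -(r : ℤ) + ι * s ≤ v 1 ∧ v 1 ≤ -(r : ℤ) + ι * s + h := by
  rw [Tube.mem_box] at hv
  simp only [transferTube] at hv
  push_cast [Nat.cast_sub hrr'] at hv
  omega

end Literature.Probability.Percolation
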